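import Literature.Probability.Percolation.CharLengthWRSW
import Literature.Probability.Percolation.OneArmQuasiMultNearCritical
import Literature.Probability.Percolation.ArmEventsAPriori
import HarnessLib

/-!
# The a priori one-arm bound below the characteristic length, both colours, every density

Topic `Literature/Probability/Percolation`; family `crit-perc`, statement **crit-perc.S16**
(`Literature.Probability.Percolation.triTheta_exponent`). Proofs only (no new definition, no new
named fact). Nolin 2008 (*Electron. J. Probab.* 13), §4.3, Prop. 14 [arXiv 0711.4948: Prop. 13],
the **a priori bounds for arm events**, upper half, `j = 1`:

> "there exist some exponents `0 < α_j, α' < ∞`, as well as constants `0 < C_j, C' < ∞`, such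
> that `C_j (n/N)^{α_j} ≤ P̂(A_{j,σ}(n, N)) ≤ C' (n/N)^{α'}` … uniformly in `p`, `P̂` between
> `P_p` and `P_{1-p}`, and `n ≤ N ≤ L(p)`. The upper bound can be obtained by using concentric
> annuli: in each of them, RSW implies that there is a probability bounded away from zero to
> observe a black circuit, preventing the existence of a white arm."

This is eq. (apriori) of Nolin's proof of Thm. 27 [arXiv: Thm. 26], Case 3, where it bounds the
two extra arms around a defect after Reimer's inequality — the use this file is written for
(the four-arm pivotal estimate behind Werner's Lemma 6.3, `Werner2009_lemma63`,
`WernerPivotalEstimates.lean`; W. Werner, PCMI 2009, Lecture 6, §3: "uniform Russo-Seymour-Welsh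
estimates for `n ≤ L(p)`. Hence … uniform estimates for the probabilities of existence of …
arms"). The tree's `exists_polyArmProb_one_le_rpow` (`ArmEventsAPriori.lean`) is the case
`p = 1/2`; here the parameter is arbitrary and the outer radius stays below Nolin's length
`L_ε(t) = charLength ε t` (every `ε ∈ (0, 1/2)`), resp. below Werner's length
`L(t, η) = charLengthW η t` (through `charLengthW_le_charLength`, `CharLengthWRSW.lean`).

## Contents (all proved)

* `exists_pos_le_real_triHexCircuit_nearCritical` — monochromatic circuits of BOTH colours in
  the hexagonal annuli `5k ≤ |·|_𝕋 ≤ 7k` have `P_t`-probability `≥ c₀(ε) > 0` for every `t` and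
  every `k ≥ 1` with `k < L_ε(t)` whenever `t ≠ 1/2` (the aspect-ratio-`7` bound
  `exists_pos_le_triLRCrossingProb_seven` at `t` for open circuits and at `1 - t` for closed ones,
  `L_ε(1 - t) = L_ε(t)`; six pieces and Harris, `pow_six_le_real_iInter_isoTBCrossing_at`).
* `real_triAnnulusCrossing_le_pow_at` — Bollobás–Riordan's product bound over disjoint annuli
  (Ch. 7, proof of Lemma 4) at an arbitrary density, with the circuit bound as a hypothesis on
  the scales used (the tree's `real_triAnnulusCrossing_le_pow` is `p = 1/2`).
* `real_triAnnulusCrossing_le_rpow_nearCritical` — for every `t`, colour `c`, `1000 ≤ u`,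
  `2u ≤ v`, and `v ≤ 7 L_ε(t)` whenever `t ≠ 1/2`: the annulus `u < ‖·‖ < v` of the unit lattice
  is crossed by a `c`-coloured walk with `P_t`-probability `≤ (u/v)^α`, `α = α(ε) > 0` (the
  arithmetic of `tri_annulusCrossing_bound_holds` verbatim).
* `exists_real_armEvent_one_le_rpow_nearCritical` — **Nolin's Prop. 14, upper bound, `j = 1`,
  below `L_ε`**: `P_t(armEvent ![c] n N) ≤ C (n/N)^α` for all `t`, both colours `c`, `1 ≤ n ≤ N`,
  and `N ≤ L_ε(t)` whenever `t ≠ 1/2`.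
* `exists_real_armEvent_one_le_rpow_lt_charLengthW` — the same below Werner's length:
  `|t - 1/2| < 1/4`, `N ≤ L(t, η)` whenever `t ≠ 1/2`.

## References

* P. Nolin, Near-critical percolation in two dimensions, *Electron. J. Probab.* 13 (2008), §4.3,
  Prop. 14 and §3.1, (3.6) [arXiv 0711.4948: Prop. 13] [Nolin2008].
* W. Werner, *Lectures on two-dimensional critical percolation*, IAS/Park City Math. Ser. 16
  (2009), Lecture 6, §3 (first paragraph) [WernerPCMI2009].
* B. Bollobás, O. Riordan, *Percolation*, CUP (2006), Ch. 7, Lemma 4, pp. 166–167 [BollobasRiordan2006].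

Tree: `triHexCircuit`, `triHexAnnulus`, `determinedBy_triHexCircuit`, `disjoint_triHexAnnulus`,
`measurableSet_triHexCircuit`, `iInter_isoTBCrossing_subset_triHexCircuit`,
`compl_preimage_iInter_isoTBCrossing_subset_triHexCircuit`,
`not_mem_triAnnulusCrossing_of_triHexCircuit`, `rpow_logb_two_comm`, `sqrt_three_bound`
(`TriAnnulusCrossingProofs.lean`), `triAnnulusCrossing`, `triAnnulusCrossing_mono`
(`TriAnnulusCrossing.lean`), `pow_six_le_real_iInter_isoTBCrossing_at`,
`exists_pos_le_triLRCrossingProb_seven` (`OneArmQuasiMultNearCritical.lean`),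
`armEvent_one_subset_triAnnulusCrossing` (`ArmEventsAPriori.lean`), `armEvent_mono_left`
(`ArmEvents*.lean`), `sitePercolation_real_iInter_eq_prod` (`OneArmLSW.lean`),
`sitePercolation_real_preimage_compl` (`TriHexLemma.lean`), `charLength_symm`
(`KestenScaling.lean`), `charLengthW_le_charLength` (`CharLengthWRSW.lean`). Mathlib: `Real.logb`,
`Real.rpow`, `probReal_compl_eq_one_sub`.
-/

noncomputable section

open MeasureTheory Set

namespace Literature.Probability.Percolation

open LatticeModels

/-! ### Circuits of both colours below `L_ε(t)` -/

/-- **Monochromatic circuits of both colours are uniformly likely below `L_ε(t)`** (Nolin 2008,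
§3.1, (3.6): "`P̂(∃ circuit in S_{N,2N}) ≥ δ₄⁴` for `N ≤ L(p)`", for black and for white circuits;
Bollobás–Riordan 2006, p. 167). For every `ε ∈ (0, 1/2)` there is `c₀ ∈ (0, 1)` such that for
every `t`, either colour `b` and every scale `k ≥ 1` with `k < L_ε(t)` whenever `t ≠ 1/2`, the
hexagonal annulus `5k ≤ |·|_𝕋 ≤ 7k` contains a `b`-coloured circuit (`triHexCircuit b k`) with
`P_t`-probability `≥ c₀`: open circuits from the six long crossings at `t`
(`exists_pos_le_triLRCrossingProb_seven`, `pow_six_le_real_iInter_isoTBCrossing_at`,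
`iInter_isoTBCrossing_subset_triHexCircuit`), closed ones from the same at `1 - t`
(`sitePercolation_real_preimage_compl`, `L_ε(1 - t) = L_ε(t)`). [cite: Nolin2008, §3.1, eq. (3.6)] [cite: BollobasRiordan2006, Ch. 7 proof of Lemma 4 p. 167] -/
theorem exists_pos_le_real_triHexCircuit_nearCritical {ε : ℝ} (hε : 0 < ε) (hε' : ε < 1 / 2) :
    ∃ c₀ : ℝ, 0 < c₀ ∧ c₀ < 1 ∧ ∀ (t : unitInterval) (b : Bool) (k : ℕ), 1 ≤ k →
      ((t : ℝ) ≠ 1 / 2 → k < charLength ε t) →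
        c₀ ≤ (triSitePercolation t).real (triHexCircuit b k) := by
  obtain ⟨c, hc, h7⟩ := exists_pos_le_triLRCrossingProb_seven hε hε'
  set c' : ℝ := min c (1 / 2) with hc'
  have hc'0 : 0 < c' := lt_min hc (by norm_num)
  refine ⟨c' ^ 6, by positivity, ?_, fun t b k hk hkL => ?_⟩
  · calc c' ^ 6 ≤ (1 / 2 : ℝ) ^ 6 := by gcongr; exact min_le_right _ _
      _ < 1 := by norm_num
  cases b
  · -- a closed circuit at `t` is an open circuit at `1 - t`
    have hσlt : ((unitInterval.symm t : unitInterval) : ℝ) < 1 / 2 →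
        k < charLength ε (unitInterval.symm t) := by
      intro h
      rw [charLength_symm]
      refine hkL ?_
      rw [unitInterval.coe_symm_eq] at h
      intro ht
      linarith
    have hP : c' ≤ triLRCrossingProb (unitInterval.symm t) (7 * k) k :=
      (min_le_left _ _).trans (h7 (unitInterval.symm t) k hk hσlt)
    calc c' ^ 6 ≤ triLRCrossingProb (unitInterval.symm t) (7 * k) k ^ 6 := by gcongr
      _ ≤ (triSitePercolation (unitInterval.symm t)).real
            (⋂ j < 6, isoTBCrossing (pieceIso k j) k (7 * k)) :=
          pow_six_le_real_iInter_isoTBCrossing_at (unitInterval.symm t) k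
      _ = (triSitePercolation t).real
            (compl ⁻¹' ⋂ j < 6, isoTBCrossing (pieceIso k j) k (7 * k)) :=
          (sitePercolation_real_preimage_compl t _).symm
      _ ≤ (triSitePercolation t).real (triHexCircuit false k) :=
          measureReal_mono (compl_preimage_iInter_isoTBCrossing_subset_triHexCircuit hk)
  · have hlt : ((t : unitInterval) : ℝ) < 1 / 2 → k < charLength ε t := fun h => hkL h.ne
    have hP : c' ≤ triLRCrossingProb t (7 * k) k := (min_le_left _ _).trans (h7 t k hk hlt)
    calc c' ^ 6 ≤ triLRCrossingProb t (7 * k) k ^ 6 := by gcongr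
      _ ≤ (triSitePercolation t).real (⋂ j < 6, isoTBCrossing (pieceIso k j) k (7 * k)) :=
          pow_six_le_real_iInter_isoTBCrossing_at t k
      _ ≤ (triSitePercolation t).real (triHexCircuit true k) :=
          measureReal_mono (iInter_isoTBCrossing_subset_triHexCircuit hk)

/-! ### The product bound at an arbitrary density -/

/-- **The product bound over disjoint annuli, every density** (Bollobás–Riordan 2006, proof of
Lemma 4, p. 167: "As the annuli `Aᵢ` are disjoint, the events `Eᵢ` are independent"): if `M`
scales `k₀ < k₁ < ⋯` with disjoint annuli (`7 k_m < 5 k_{m'}` for `m < m'`) fit between the radii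
(`R₁ < (√3/2) 5 k_m`, `7 k_m < R₂`) and at each of them a circuit of colour `!c` has
`P_p`-probability `≥ c₀`, then the annulus `(R₁, R₂)` about the origin is crossed by a `c`-coloured
walk with `P_p`-probability `≤ (1 - c₀)^M`. The tree's `real_triAnnulusCrossing_le_pow` is the case
`p = 1/2` (with the circuit bound at all scales); same proof. [cite: BollobasRiordan2006, Ch. 7 proof of Lemma 4 p. 167] -/
theorem real_triAnnulusCrossing_le_pow_at (p : unitInterval) {c₀ : ℝ} (c : Bool) {R₁ R₂ : ℝ}
    (k : ℕ → ℕ) (M : ℕ)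
    (hc₀ : ∀ m < M, c₀ ≤ (triSitePercolation p).real (triHexCircuit (!c) (k m)))
    (hfit1 : ∀ m < M, R₁ < Real.sqrt 3 / 2 * (5 * k m)) (hfit2 : ∀ m < M, (7 * k m : ℝ) < R₂)
    (hdisj : ∀ m m', m < m' → 7 * k m < 5 * k m') :
    (triSitePercolation p).real (triAnnulusCrossing c 1 0 R₁ R₂) ≤ (1 - c₀) ^ M := by
  have hsub : triAnnulusCrossing c 1 0 R₁ R₂ ⊆ ⋂ m < M, (triHexCircuit (!c) (k m))ᶜ := by
    intro ω hω
    simp only [Set.mem_iInter, Set.mem_compl_iff]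
    intro m hm hcirc
    have := not_mem_triAnnulusCrossing_of_triHexCircuit (hfit1 m hm) (hfit2 m hm) hcirc
    rw [Bool.not_not] at this
    exact this hω
  have hprod := sitePercolation_real_iInter_eq_prod p
    (Y := fun m => (triHexCircuit (!c) (k m))ᶜ) (F := fun m => triHexAnnulus (k m)) (N := M)
    (fun m _ => (determinedBy_triHexCircuit _ _).compl)
    (fun m m' hmm' _ => disjoint_triHexAnnulus (hdisj m m' hmm'))
  calc (triSitePercolation p).real (triAnnulusCrossing c 1 0 R₁ R₂)
      ≤ (triSitePercolation p).real (⋂ m < M, (triHexCircuit (!c) (k m))ᶜ) :=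
        measureReal_mono hsub
    _ = ∏ m ∈ Finset.range M, (triSitePercolation p).real (triHexCircuit (!c) (k m))ᶜ := by
        exact hprod
    _ ≤ ∏ _m ∈ Finset.range M, (1 - c₀) := by
        refine Finset.prod_le_prod (fun m _ => measureReal_nonneg) fun m hm => ?_
        rw [probReal_compl_eq_one_sub (measurableSet_triHexCircuit _ _)]
        linarith [hc₀ m (Finset.mem_range.1 hm)]
    _ = (1 - c₀) ^ M := by rw [Finset.prod_const, Finset.card_range]

/-! ### The annulus bound below `L_ε(t)` -/

/-- **Bollobás–Riordan's annulus lemma below `L_ε(t)`, every density, unit lattice** (Ch. 7,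
Lemma 4, pp. 166–167; Nolin 2008, Prop. 14, upper bound, `j = 1`): for every `ε ∈ (0, 1/2)` there
is `α > 0` such that for every `t`, either colour `c`, and radii `1000 ≤ u`, `2u ≤ v` with
`v ≤ 7 L_ε(t)` whenever `t ≠ 1/2`, a `c`-coloured walk of `𝕋` from `‖x‖ < u` to `‖y‖ > v` has
`P_t`-probability `≤ (u/v)^α`. Proof as for `tri_annulusCrossing_bound_holds` (radii `u + 2`,
`v - 2`; scales `k_m = k₀ 2^m`, `k₀ = ⌊(u + 2)/4.33⌋ + 1`, `m < M = ⌈log₂ ((v - 2)/(7 k₀))⌉`, all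
`< L_ε(t)` since `7 k_m < v ≤ 7 L_ε(t)`; circuits of colour `!c` from
`exists_pos_le_real_triHexCircuit_nearCritical`; `(1 - c₀)^M ≤ (u/v)^{β/4}`,
`β = -log₂ (1 - c₀)`). [cite: BollobasRiordan2006, Ch. 7 Lemma 4 pp. 166–167] [cite: Nolin2008, §4.3, Prop. 14 (arXiv 0711.4948: Prop. 13)] -/
theorem real_triAnnulusCrossing_le_rpow_nearCritical {ε : ℝ} (hε : 0 < ε) (hε' : ε < 1 / 2) :
    ∃ α : ℝ, 0 < α ∧ ∀ (t : unitInterval) (c : Bool) (u v : ℝ), 1000 ≤ u → 2 * u ≤ v →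
      ((t : ℝ) ≠ 1 / 2 → v ≤ 7 * charLength ε t) →
        (triSitePercolation t).real (triAnnulusCrossing c 1 0 u v) ≤ (u / v) ^ α := by
  obtain ⟨c₀, hc₀, hc₁, hcirc⟩ := exists_pos_le_real_triHexCircuit_nearCritical hε hε'
  have h1c : 0 < 1 - c₀ := by linarith
  have h1c' : 1 - c₀ < 1 := by linarith
  set β : ℝ := -Real.logb 2 (1 - c₀) with hβ
  have hβpos : 0 < β := by
    have := Real.logb_neg one_lt_two h1c h1c'
    linarith
  refine ⟨β / 4, by positivity, ?_⟩
  intro t c u v hu0 huv hvL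
  set R₁ : ℝ := u + 2 with hR₁
  set R₂ : ℝ := v - 2 with hR₂
  have hP : (triSitePercolation t).real (triAnnulusCrossing c 1 0 u v) ≤
      (triSitePercolation t).real (triAnnulusCrossing c 1 0 R₁ R₂) :=
    measureReal_mono (triAnnulusCrossing_mono (by rw [hR₁]; linarith) (by rw [hR₂]; linarith))
  -- the scales
  set k₀ : ℕ := ⌊R₁ / (433 / 100)⌋₊ + 1 with hk₀
  have hk₀gt : R₁ / (433 / 100) < k₀ := by
    rw [hk₀]; push_cast; exact Nat.lt_floor_add_one _
  have hk₀le : (k₀ : ℝ) ≤ R₁ / (433 / 100) + 1 := by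
    rw [hk₀]; push_cast
    have := Nat.floor_le (show (0 : ℝ) ≤ R₁ / (433 / 100) by rw [hR₁]; positivity)
    linarith
  have hk₀1 : 1 ≤ k₀ := by rw [hk₀]; omega
  have hk₀pos : (0 : ℝ) < k₀ := by exact_mod_cast hk₀1
  have h7k : (7 * k₀ : ℝ) ≤ 1627 / 1000 * u := by
    have : (7 * k₀ : ℝ) ≤ 7 * (R₁ / (433 / 100) + 1) := by linarith
    rw [hR₁] at this
    nlinarith
  have hR₂v : 999 / 1000 * v ≤ R₂ := by rw [hR₂]; linarith
  have hv0 : 2000 ≤ v := by linarith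
  have hR₂pos : 0 < R₂ := by linarith
  have h7kR : (7 * k₀ : ℝ) ≤ R₂ := by linarith
  set L : ℝ := Real.logb 2 (R₂ / (7 * k₀)) with hL
  set M : ℕ := ⌈L⌉₊ with hM
  have hq : 0 < R₂ / (7 * k₀) := by positivity
  -- the scales used are below `L_ε(t)`
  have hfit2 : ∀ m < M, (7 * (k₀ * 2 ^ m : ℕ) : ℝ) < R₂ := by
    intro m hm
    have hmL : (m : ℝ) < L := (Nat.lt_ceil).1 (by rwa [hM] at hm)
    have h2 : (2 : ℝ) ^ (m : ℝ) < 2 ^ L := Real.rpow_lt_rpow_of_exponent_lt one_lt_two hmL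
    rw [Real.rpow_natCast, hL, Real.rpow_logb two_pos (by norm_num) hq] at h2
    push_cast
    rw [lt_div_iff₀ (by positivity)] at h2
    calc (7 : ℝ) * (k₀ * 2 ^ m) = 2 ^ m * (7 * k₀) := by ring
      _ < R₂ := h2
  have hscale : ∀ m < M, (t : ℝ) ≠ 1 / 2 → k₀ * 2 ^ m < charLength ε t := by
    intro m hm ht
    have h1 := hfit2 m hm
    have h2 := hvL ht
    have h3 : (7 * (k₀ * 2 ^ m : ℕ) : ℝ) < 7 * charLength ε t := by
      have : R₂ < v := by rw [hR₂]; linarith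
      linarith
    have h4 : ((k₀ * 2 ^ m : ℕ) : ℝ) < charLength ε t := by linarith
    exact_mod_cast h4
  -- the product bound
  have hbound := real_triAnnulusCrossing_le_pow_at t c (R₁ := R₁) (R₂ := R₂)
    (fun m => k₀ * 2 ^ m) M
    (fun m hm => hcirc t (!c) _ (hk₀1.trans (Nat.le_mul_of_pos_right _ (Nat.two_pow_pos m)))
      (hscale m hm))
    (fun m _ => by
      have h2m : (1 : ℝ) ≤ 2 ^ m := one_le_pow₀ (by norm_num)
      have hR₁lt : R₁ < 433 / 100 * k₀ := by
        rw [div_lt_iff₀ (by norm_num : (0 : ℝ) < 433 / 100)] at hk₀gt; linarith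
      push_cast
      calc R₁ < 433 / 100 * k₀ := hR₁lt
        _ ≤ 433 / 100 * (k₀ * 2 ^ m) := by nlinarith
        _ ≤ Real.sqrt 3 / 2 * 5 * (k₀ * 2 ^ m) :=
            mul_le_mul_of_nonneg_right sqrt_three_bound (by positivity)
        _ = Real.sqrt 3 / 2 * (5 * (k₀ * 2 ^ m)) := by ring)
    hfit2
    (fun m m' hmm' => by
      have h1 : 2 * 2 ^ m ≤ 2 ^ m' := by
        rw [← pow_succ']; exact Nat.pow_le_pow_right two_pos hmm'
      have h2 : k₀ * (2 * 2 ^ m) ≤ k₀ * 2 ^ m' := Nat.mul_le_mul_left k₀ h1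
      have h3 : 0 < k₀ * 2 ^ m := Nat.mul_pos hk₀1 (Nat.two_pow_pos m)
      nlinarith [h2, h3])
  -- the arithmetic: `(1 - c₀)^M ≤ (u/v)^(β/4)`
  have hLM : L ≤ M := by rw [hM]; exact Nat.le_ceil L
  have step1 : (1 - c₀) ^ M ≤ (1 - c₀) ^ L := by
    rw [← Real.rpow_natCast]
    exact Real.rpow_le_rpow_of_exponent_ge h1c h1c'.le hLM
  have step2 : (1 - c₀) ^ L = (7 * k₀ / R₂) ^ β := by
    have hlog : Real.logb 2 (1 - c₀) = -β := by rw [hβ]; ring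
    rw [hL, rpow_logb_two_comm h1c hq, hlog, Real.rpow_neg hq.le, ← Real.inv_rpow hq.le, inv_div]
  have hupos : 0 < u := by linarith
  have hvpos : 0 < v := by linarith
  have hρ : 7 * k₀ / R₂ ≤ 1629 / 1000 * (u / v) := by
    rw [div_le_iff₀ hR₂pos]
    calc (7 * k₀ : ℝ) ≤ 1627 / 1000 * u := h7k
      _ = 1629 / 1000 * (u / v) * (1627 / 1629 * v) := by field_simp
      _ ≤ 1629 / 1000 * (u / v) * R₂ := by
          apply mul_le_mul_of_nonneg_left _ (by positivity)
          linarith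
  have hρ0 : 0 ≤ 7 * k₀ / R₂ := by positivity
  have hρ1 : u / v ≤ 1 / 2 := by rw [div_le_iff₀ hvpos]; linarith
  have hρpos : 0 ≤ u / v := by positivity
  have step3 : (7 * k₀ / R₂) ^ β ≤ (1629 / 1000 * (u / v)) ^ β :=
    Real.rpow_le_rpow hρ0 hρ hβpos.le
  have step4 : (1629 / 1000 * (u / v)) ^ β ≤ (u / v) ^ (β / 4) := by
    set ρ := u / v with hρdef
    have hx : 0 ≤ 1629 / 1000 * ρ := by positivity
    have hpow : (1629 / 1000 * ρ) ^ β = ((1629 / 1000 * ρ) ^ (4 : ℕ)) ^ (β / 4) := by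
      rw [← Real.rpow_natCast, ← Real.rpow_mul hx]
      congr 1
      push_cast
      ring
    rw [hpow]
    refine Real.rpow_le_rpow (by positivity) ?_ (by positivity)
    -- `(1.629 ρ)^4 ≤ ρ` for `0 ≤ ρ ≤ 1/2`
    nlinarith [mul_nonneg hρpos hρpos, mul_nonneg (mul_nonneg hρpos hρpos) hρpos, hρ1]
  calc (triSitePercolation t).real (triAnnulusCrossing c 1 0 u v)
      ≤ (triSitePercolation t).real (triAnnulusCrossing c 1 0 R₁ R₂) := hP
    _ ≤ (1 - c₀) ^ M := hbound
    _ ≤ (1 - c₀) ^ L := step1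
    _ = (7 * k₀ / R₂) ^ β := step2
    _ ≤ (1629 / 1000 * (u / v)) ^ β := step3
    _ ≤ (u / v) ^ (β / 4) := step4

/-! ### The a priori one-arm bound -/

/-- **A priori upper bound for one arm below `L_ε(t)`, every density, both colours** (Nolin 2008,
Prop. 14 [arXiv 0711.4948: Prop. 13], upper half, `j = 1`: "`P̂(A_{1,σ}(n, N)) ≤ C' (n/N)^{α'}`
uniformly in `p`, `P̂` between `P_p` and `P_{1-p}`, `n ≤ N ≤ L(p)` … by using concentric annuli";
Werner 2009, Lecture 6, §3, first paragraph). For every `ε ∈ (0, 1/2)` there are `C, α > 0` with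
`P_t(armEvent ![c] n N) ≤ C (n/N)^α` for every `t`, both colours `c`, all `1 ≤ n ≤ N`, provided
`N ≤ L_ε(t)` when `t ≠ 1/2`. An arm across `Λ_N ∖ Λ_n` crosses the Euclidean annulus
`A(n + 1, 0.86 N)` (`armEvent_one_subset_triAnnulusCrossing`); then
`real_triAnnulusCrossing_le_rpow_nearCritical` at the intermediate radius `m = max n 999` and the
trivial bound for `N < 3000 n` (the bookkeeping of `exists_polyArmProb_one_le_rpow`, the case
`t = 1/2`). [cite: Nolin2008, §4.3, Prop. 14 (arXiv 0711.4948: Prop. 13)] [cite: WernerPCMI2009, Lecture 6, §3 (first paragraph)] -/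
theorem exists_real_armEvent_one_le_rpow_nearCritical {ε : ℝ} (hε : 0 < ε) (hε' : ε < 1 / 2) :
    ∃ C α : ℝ, 0 < C ∧ 0 < α ∧ ∀ (t : unitInterval) (c : Bool) (n N : ℕ), 1 ≤ n → n ≤ N →
      ((t : ℝ) ≠ 1 / 2 → N ≤ charLength ε t) →
        (triSitePercolation t).real (armEvent ![c] n N) ≤ C * ((n : ℝ) / N) ^ α := by
  obtain ⟨α, hα, hb⟩ := real_triAnnulusCrossing_le_rpow_nearCritical hε hε'
  refine ⟨(3000 : ℝ) ^ α, α, by positivity, hα, fun t c n N hn hnN hNL => ?_⟩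
  have hle1 : (triSitePercolation t).real (armEvent ![c] n N) ≤ 1 := measureReal_le_one
  have hn' : (1 : ℝ) ≤ n := by exact_mod_cast hn
  have hN' : (n : ℝ) ≤ N := by exact_mod_cast hnN
  have hNpos : (0 : ℝ) < N := by linarith
  have hratio_pos : 0 < (n : ℝ) / N := by positivity
  -- the main case: `999 ≤ m ≤ N / 3 - 1`, for an intermediate radius `m`
  have main : ∀ m : ℕ, 999 ≤ m → 3 * m + 3 ≤ N → n ≤ m →
      (triSitePercolation t).real (armEvent ![c] n N) ≤ (3 : ℝ) ^ α * ((m : ℝ) / N) ^ α := by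
    intro m hm hmN hnm
    have hmN' : m ≤ N := by omega
    have h1 : (triSitePercolation t).real (armEvent ![c] n N) ≤
        (triSitePercolation t).real (armEvent ![c] m N) :=
      measureReal_mono (armEvent_mono_left _ hnm hmN') (measure_ne_top _ _)
    have h2 : (triSitePercolation t).real (armEvent ![c] m N) ≤
        (triSitePercolation t).real (triAnnulusCrossing c 1 0 ((m : ℝ) + 1) (86 / 100 * N)) :=
      measureReal_mono (armEvent_one_subset_triAnnulusCrossing c (by omega)) (measure_ne_top _ _)
    have hm' : (999 : ℝ) ≤ m := by exact_mod_cast hm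
    have hmN'' : (3 : ℝ) * m + 3 ≤ N := by exact_mod_cast hmN
    have h3 := hb t c ((m : ℝ) + 1) (86 / 100 * N) (by linarith) (by nlinarith) (fun ht => by
      have := hNL ht
      have : (N : ℝ) ≤ charLength ε t := by exact_mod_cast this
      linarith)
    refine h1.trans (h2.trans (h3.trans ?_))
    have hq : ((m : ℝ) + 1) / (86 / 100 * N) ≤ 3 * ((m : ℝ) / N) := by
      rw [div_le_iff₀ (by positivity)]
      have : 3 * ((m : ℝ) / N) * (86 / 100 * N) = (258 / 100) * m := by
        field_simp
        ring
      rw [this]; linarith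
    calc (((m : ℝ) + 1) / (86 / 100 * N)) ^ α ≤ (3 * ((m : ℝ) / N)) ^ α :=
          Real.rpow_le_rpow (by positivity) hq hα.le
      _ = (3 : ℝ) ^ α * ((m : ℝ) / N) ^ α := Real.mul_rpow (by norm_num) (by positivity)
  -- trivial bound `1 ≤ 3000^α (n/N)^α` when `N < 3000 n`
  have small : (N : ℝ) < 3000 * n →
      (triSitePercolation t).real (armEvent ![c] n N) ≤ (3000 : ℝ) ^ α * ((n : ℝ) / N) ^ α := by
    intro hlt
    refine hle1.trans ?_
    have h1 : (1 : ℝ) ≤ 3000 * ((n : ℝ) / N) := by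
      rw [mul_div_assoc', le_div_iff₀ hNpos]; linarith
    calc (1 : ℝ) = 1 ^ α := (Real.one_rpow α).symm
      _ ≤ (3000 * ((n : ℝ) / N)) ^ α := Real.rpow_le_rpow zero_le_one h1 hα.le
      _ = (3000 : ℝ) ^ α * ((n : ℝ) / N) ^ α := Real.mul_rpow (by norm_num) (by positivity)
  by_cases hN3 : (N : ℝ) < 3000 * n
  · exact small hN3
  rw [not_lt] at hN3
  have hN3' : 3000 * n ≤ N := by exact_mod_cast hN3
  by_cases hn9 : 999 ≤ n
  · -- `m = n`
    have h := main n hn9 (by omega) le_rfl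
    refine h.trans ?_
    gcongr
    · norm_num
  · -- `m = 999`
    rw [not_le] at hn9
    have h := main 999 le_rfl (by omega) hn9.le
    refine h.trans ?_
    have hq : ((999 : ℕ) : ℝ) / N ≤ 999 * ((n : ℝ) / N) := by
      rw [mul_div_assoc', div_le_div_iff_of_pos_right hNpos]
      push_cast; linarith
    calc (3 : ℝ) ^ α * (((999 : ℕ) : ℝ) / N) ^ α ≤ (3 : ℝ) ^ α * (999 * ((n : ℝ) / N)) ^ α := by
          gcongr
      _ = ((3 : ℝ) ^ α * (999 : ℝ) ^ α) * ((n : ℝ) / N) ^ α := by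
          rw [Real.mul_rpow (by norm_num) (by positivity)]; ring
      _ = ((3 * 999 : ℝ)) ^ α * ((n : ℝ) / N) ^ α := by
          rw [← Real.mul_rpow (by norm_num) (by norm_num)]
      _ ≤ (3000 : ℝ) ^ α * ((n : ℝ) / N) ^ α := by
          gcongr
          · norm_num

/-- **A priori upper bound for one arm below Werner's length `L(t, η)`, both colours** (Werner
2009, Lecture 6, §3, first paragraph: the uniform Russo–Seymour–Welsh estimates for `n ≤ L(p)`
"imply uniform estimates for the probabilities of existence" of arms; Nolin 2008, Prop. 14, upper
half, `j = 1`). For every `η > 0` there are `C, α > 0` with `P_t(armEvent ![c] n N) ≤ C (n/N)^α`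
for every `t` with `|t - 1/2| < 1/4`, both colours, all `1 ≤ n ≤ N`, provided `N ≤ L(t, η)` when
`t ≠ 1/2` — `exists_real_armEvent_one_le_rpow_nearCritical` at the `ε(η)` of
`charLengthW_le_charLength`. [cite: WernerPCMI2009, Lecture 6, §3 (first paragraph)] [cite: Nolin2008, §4.3, Prop. 14 (arXiv 0711.4948: Prop. 13)] -/
theorem exists_real_armEvent_one_le_rpow_lt_charLengthW {η : ℝ} (hη : 0 < η) :
    ∃ C α : ℝ, 0 < C ∧ 0 < α ∧ ∀ (t : unitInterval) (c : Bool) (n N : ℕ),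
      |(t : ℝ) - 1 / 2| < 1 / 4 → 1 ≤ n → n ≤ N → ((t : ℝ) ≠ 1 / 2 → N ≤ charLengthW η t) →
        (triSitePercolation t).real (armEvent ![c] n N) ≤ C * ((n : ℝ) / N) ^ α := by
  obtain ⟨ε, hε, hε2, hWL⟩ := charLengthW_le_charLength hη
  obtain ⟨C, α, hC, hα, h⟩ := exists_real_armEvent_one_le_rpow_nearCritical hε hε2
  exact ⟨C, α, hC, hα, fun t c n N ht hn hnN hNL =>
    h t c n N hn hnN fun hne => (hNL hne).trans (hWL t hne ht)⟩

end Literature.Probability.Percolation
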